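import Mathlib
import Summits.Ventures.HodgeRepro2.T5AmiceTransform

/-!
# T5AmiceDirac — the Amice transform of a point mass: `δ_n ↦ (1 + T)^n`, the normalisation
«W[[Γ_𝔭]] ≅ W[[T]], γ₀ ↦ 1 + T» of S5

Cell pub-hodge-repro2, Tier 5 support (seat p7; route/T5-CHECK-G-p7.md §3 S5). S5 writes the Iwasawa
algebra of `Γ_𝔭 ≅ ℤ_p` as `W[[T]]` via `γ₀ ↦ 1 + T`. In the measure model the group element `γ₀^a`
(`a ∈ ℤ_p`, `γ₀ ↦ 1`) is the point mass `δ_a : φ ↦ φ(a)`, and its Amice transform is the binomial series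
`Σ_n (a choose n) Tⁿ = (1 + T)^a`:

* `dirac a` — the point mass, a bounded functional (`norm_dirac_le`), with `∫κ dδ_a = κ(a)`;
* `coeff_amice_dirac`: `coeff_n f_{δ_a} = (a choose n)` (Mathlib's `Ring.choose` on the binomial ring `ℤ_p`);
* `amice_dirac_natCast`: for `n ∈ ℕ`, `f_{δ_n} = (1 + T)^n` — in particular `f_{δ_1} = 1 + T`
  (`amice_dirac_one`: «γ₀ ↦ 1 + T») and `f_{δ_0} = 1` (the unit);
* `map_addChar_dirac_natCast`: `∫κ dδ_n = κ(1)^n = (1 + (κ 1 − 1))^n`, the value of `(1 + T)^n` at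
  `T = κ 1 − 1` — consistent with T5AmiceTransform's `∫κ dm = f_m(κ 1 − 1)`.

Mathlib + own T5AmiceTransform.
-/

namespace Summit.Ventures.HodgeRepro2.T5AmiceDirac

open PadicInt Filter Topology
open Summit.Ventures.HodgeRepro2.T5AmiceTransform

variable {p : ℕ} [hp : Fact p.Prime]
variable {R : Type*} [NormedCommRing R] [Algebra ℤ_[p] R] [IsBoundedSMul ℤ_[p] R]

/-- THE POINT MASS at `a ∈ ℤ_p`: `δ_a(φ) := φ(a)` (the group element `γ₀^a` of `W[[Γ_𝔭]]`). -/
noncomputable def dirac (a : ℤ_[p]) : C(ℤ_[p], R) →ₗ[R] R where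
  toFun φ := φ a
  map_add' _ _ := rfl
  map_smul' _ _ := rfl

omit [Algebra ℤ_[p] R] [IsBoundedSMul ℤ_[p] R] in
/-- `δ_a(φ) = φ(a)`. -/
@[simp] theorem dirac_apply (a : ℤ_[p]) (φ : C(ℤ_[p], R)) : dirac a φ = φ a := rfl

omit [Algebra ℤ_[p] R] [IsBoundedSMul ℤ_[p] R] in
/-- `δ_a` is bounded by `1`. -/
theorem norm_dirac_le (a : ℤ_[p]) (φ : C(ℤ_[p], R)) : ‖dirac a φ‖ ≤ 1 * ‖φ‖ := by
  rw [dirac_apply, one_mul]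
  exact φ.norm_coe_le_norm a

omit [Algebra ℤ_[p] R] [IsBoundedSMul ℤ_[p] R] in
/-- `δ_a` is continuous. -/
theorem continuous_dirac (a : ℤ_[p]) : Continuous (dirac (R := R) a) :=
  continuous_of_bound _ 1 (norm_dirac_le a)

omit [Algebra ℤ_[p] R] [IsBoundedSMul ℤ_[p] R] in
/-- `∫κ dδ_a = κ(a)` for every character `κ`. -/
theorem dirac_addChar (a : ℤ_[p]) (κ : AddChar ℤ_[p] R) (hκ : Continuous κ) :
    dirac a (⟨κ, hκ⟩ : C(ℤ_[p], R)) = κ a := rfl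

/-- The coefficients of `f_{δ_a}` are the binomial coefficients `(a choose n) • 1`
(Mathlib's `Ring.choose` on the binomial ring `ℤ_p`, via the Mahler basis `mahler n = (x choose n)`). -/
theorem coeff_amice_dirac (a : ℤ_[p]) (n : ℕ) :
    PowerSeries.coeff n (amice (dirac (R := R) a)) = Ring.choose a n • (1 : R) := by
  rw [coeff_amice, dirac_apply, mahlerTerm_apply, mahler_apply]

/-- For `n ∈ ℕ`, `coeff_k f_{δ_n} = (n choose k)`. -/
theorem coeff_amice_dirac_natCast (n k : ℕ) :
    PowerSeries.coeff k (amice (dirac (R := R) (n : ℤ_[p]))) = (n.choose k : R) := by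
  rw [coeff_amice, dirac_apply, mahlerTerm_apply, mahler_natCast_eq, Nat.cast_smul_eq_nsmul,
    nsmul_eq_mul, mul_one]

/-- «γ₀^n ↦ (1 + T)^n»: the Amice transform of the point mass at `n ∈ ℕ` is `(1 + T)^n`. -/
theorem amice_dirac_natCast (n : ℕ) :
    amice (dirac (R := R) (n : ℤ_[p])) = (1 + PowerSeries.X) ^ n := by
  ext k
  rw [coeff_amice_dirac_natCast, ← Polynomial.coe_X, ← Polynomial.coe_one, ← Polynomial.coe_add,
    ← Polynomial.coe_pow, Polynomial.coeff_coe, Polynomial.coeff_one_add_X_pow]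

/-- «γ₀ ↦ 1 + T»: the Amice transform of the point mass at `1` is `1 + T`. -/
theorem amice_dirac_one : amice (dirac (R := R) (1 : ℤ_[p])) = 1 + PowerSeries.X := by
  have h := amice_dirac_natCast (R := R) (p := p) 1
  rwa [Nat.cast_one, pow_one] at h

/-- The point mass at `0` is the unit: `f_{δ_0} = 1`. -/
theorem amice_dirac_zero : amice (dirac (R := R) (0 : ℤ_[p])) = 1 := by
  have h := amice_dirac_natCast (R := R) (p := p) 0
  rwa [Nat.cast_zero, pow_zero] at h

omit [Algebra ℤ_[p] R] [IsBoundedSMul ℤ_[p] R] in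
/-- `∫κ dδ_n = κ(1)^n = (1 + (κ 1 − 1))^n`: the value of `(1 + T)^n` at `T = κ 1 − 1`. -/
theorem dirac_natCast_addChar (n : ℕ) (κ : AddChar ℤ_[p] R) (hκ : Continuous κ) :
    dirac (n : ℤ_[p]) (⟨κ, hκ⟩ : C(ℤ_[p], R)) = (1 + (κ 1 - 1)) ^ n := by
  rw [dirac_addChar, add_sub_cancel, ← nsmul_one, AddChar.map_nsmul_eq_pow]

end Summit.Ventures.HodgeRepro2.T5AmiceDirac
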